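import Literature.AlgebraicGeometry.Surfaces.K3MarkingProofs
import Literature.AlgebraicGeometry.HodgeTheory.RationalLatticeIntegral

/-!
# Route NikulinTwinTransport · `RealMultiplicationGlue` (stmt-HodgeConjecture-13681) —
# bookkeeping in an integral marking with arbitrary Gram matrix

Helper file (supports stmt-HodgeConjecture-13681). The sibling file
`NikulinTwinTransportRealMultiplicationIntegralBasis` gives every smooth projective surface `S` an
integral marking `η : H²(S(ℂ); ℂ) ≅ ℂ^ι` with a symmetric unimodular Gram matrix `G`
(`a ∪ b = (ηa)ᵀ G (ηb) • p`). This file redoes, for an ARBITRARY index type `ι` and Gram matrix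
`G`, the coordinate bookkeeping which `K3SurfaceProofs.lean` /
`NikulinTwinTransportRealMultiplicationCore.lean` do for `(K3Index, Λ_{K3})`:

* `ratCastVec_*` — the inclusion `ℚ^ι ⊂ ℂ^ι`;
* `toBilin'_map_ratCast`, `isSymm_toBilin'_map`, `nondegenerate_toBilin'_map_rat` — the forms
  `x ↦ xᵀ G y` over `ℚ` and `ℂ` (Mathlib's `Matrix.toBilin'`), symmetric for `Gᵀ = G`,
  non-degenerate over `ℚ` for `det G = ±1`;
* `isRationalClass_iff_of_integralMarking` — under an integral marking the rational classes are
  exactly `η⁻¹(ℚ^ι)` (rational classes have integral multiples,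
  `IsRationalClass.exists_nsmul_isIntegralClass`);
* `exists_ratEnd_of_forall_intCast'`, `toBilin'_of_ratRestriction` — an endomorphism of `ℂ^ι`
  mapping `ℤ^ι` into `ℚ^ι` is the complexification of a `ℚ`-linear one, and a similitude of the
  rational form complexifies to a similitude of the complex form;
* `conjClass_integralMarking_symm` — complex conjugation acts on coordinates.

Folklore linear algebra; everything is proved. Prover seat prover-pitem-stmt-HodgeConjecture-13681-2.
-/

noncomputable section

namespace Summit.HodgeConjecture.HodgeConjecture.Theorems.NikulinTwinTransport

open CategoryTheory Module
open Literature.AlgebraicGeometry Literature.AlgebraicGeometry.Motives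
open Literature.AlgebraicGeometry.HodgeTheory Literature.AlgebraicGeometry.Surfaces
open Literature.AlgebraicTopology.SingularHomology

/-! ### `ℚ^ι ⊂ ℂ^ι`: casting lemmas -/

section Cast

variable {ι : Type*}

/-- `ℚ^ι ⊂ ℂ^ι` is additive. [folklore] -/
theorem ratCastVec_add (u v : ι → ℚ) :
    (fun i => ((u + v) i : ℂ)) = (fun i => (u i : ℂ)) + fun i => (v i : ℂ) := by
  funext i; simp only [Pi.add_apply, Rat.cast_add]

/-- `ℚ^ι ⊂ ℂ^ι` is compatible with rational scalars. [folklore] -/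
theorem ratCastVec_smul (q : ℚ) (u : ι → ℚ) :
    (fun i => ((q • u) i : ℂ)) = (q : ℂ) • fun i => (u i : ℂ) := by
  funext i; simp only [Pi.smul_apply, smul_eq_mul, Rat.cast_mul]

/-- `ℚ^ι ⊂ ℂ^ι` is injective. [folklore] -/
theorem ratCastVec_injective {u v : ι → ℚ}
    (h : (fun i => (u i : ℂ)) = fun i => (v i : ℂ)) : u = v := by
  funext i
  exact Rat.cast_injective (congrFun h i)

/-- `ℚ^ι ⊂ ℂ^ι` commutes with finite sums. [folklore] -/
theorem ratCastVec_sum {κ : Type*} (s : Finset κ) (u : κ → ι → ℚ) :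
    (fun i => ((∑ j ∈ s, u j) i : ℂ)) = ∑ j ∈ s, fun i => (u j i : ℂ) := by
  funext i; simp only [Finset.sum_apply, Rat.cast_sum]

/-- The zero vector of `ℚ^ι` is the zero vector of `ℂ^ι`. [folklore] -/
theorem ratCastVec_zero : (fun i : ι => (((0 : ι → ℚ) i : ℚ) : ℂ)) = 0 := by
  funext i; simp

/-- An integral vector of `ℂ^ι` is (the image of) a rational one. [folklore] -/
theorem intCastVec_eq_ratCastVec (v : ι → ℤ) :
    (fun i => (v i : ℂ)) = fun i => (((v i : ℚ)) : ℂ) := by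
  funext i
  rw [Rat.cast_intCast]

/-- The standard basis of `ℂ^ι` consists of rational vectors. [folklore] -/
theorem basisFun_eq_ratCastVec [Fintype ι] [DecidableEq ι] (j : ι) :
    (Pi.basisFun ℂ ι) j = fun i => ((Pi.single j (1 : ℚ) : ι → ℚ) i : ℂ) := by
  rw [Pi.basisFun_apply]
  funext i
  by_cases hij : i = j
  · subst hij; simp only [Pi.single_eq_same, Rat.cast_one]
  · simp only [Pi.single_apply, if_neg hij, Rat.cast_zero]

/-- A complex vector is the combination of the integral standard basis vectors with its
coordinates as coefficients. [folklore] -/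
theorem eq_sum_smul_intCastVec_single [Fintype ι] [DecidableEq ι] (z : ι → ℂ) :
    z = ∑ j, z j • fun i => ((Pi.single j (1 : ℤ) : ι → ℤ) i : ℂ) := by
  funext i
  simp only [Finset.sum_apply, Pi.smul_apply, smul_eq_mul, Pi.single_apply, Int.cast_ite,
    Int.cast_one, Int.cast_zero, mul_ite, mul_one, mul_zero]
  rw [Finset.sum_ite_eq, if_pos (Finset.mem_univ i)]

end Cast

/-! ### The forms `xᵀ G y` over `ℚ` and over `ℂ` -/

section Form

variable {ι : Type*} [Fintype ι] [DecidableEq ι]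

/-- The complex form `xᵀ G y` restricted to `ℚ^ι ⊂ ℂ^ι` is the rational form. [folklore] -/
theorem toBilin'_map_ratCast (G : Matrix ι ι ℤ) (a b : ι → ℚ) :
    Matrix.toBilin' (G.map (Int.cast : ℤ → ℂ)) (fun i => (a i : ℂ)) (fun i => (b i : ℂ)) =
      ((Matrix.toBilin' (G.map (Int.cast : ℤ → ℚ)) a b : ℚ) : ℂ) := by
  rw [Matrix.toBilin'_apply, Matrix.toBilin'_apply]
  simp only [Matrix.map_apply, Rat.cast_sum, Rat.cast_mul, Rat.cast_intCast]

/-- The rational form `xᵀ G y` restricted to `ℤ^ι` is integral. [folklore] -/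
theorem toBilin'_map_intCast (G : Matrix ι ι ℤ) (v w : ι → ℤ) :
    Matrix.toBilin' (G.map (Int.cast : ℤ → ℚ)) (fun i => (v i : ℚ)) (fun i => (w i : ℚ)) =
      ((∑ i, ∑ j, v i * G i j * w j : ℤ) : ℚ) := by
  rw [Matrix.toBilin'_apply]
  simp only [Matrix.map_apply, Int.cast_sum, Int.cast_mul]

/-- The form `xᵀ G y` of a symmetric matrix is symmetric (over any commutative ring of
coefficients into which `G` is cast). [folklore] -/
theorem isSymm_toBilin'_map {R : Type*} [CommRing R] (G : Matrix ι ι ℤ) (hG : G.transpose = G) :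
    (Matrix.toBilin' (G.map (Int.cast : ℤ → R))).IsSymm := by
  refine ⟨fun a b => ?_⟩
  rw [Matrix.toBilin'_apply, Matrix.toBilin'_apply, Finset.sum_comm]
  refine Finset.sum_congr rfl fun i _ => Finset.sum_congr rfl fun j _ => ?_
  have hij : G j i = G i j := by rw [← hG, Matrix.transpose_apply, hG]
  rw [Matrix.map_apply, Matrix.map_apply, hij]
  ring

/-- **The rational form of a unimodular matrix is non-degenerate** (`det G = ±1 ≠ 0` in `ℚ`).
[folklore] -/
theorem nondegenerate_toBilin'_map_rat (G : Matrix ι ι ℤ) (hG : IsUnit G.det) :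
    (Matrix.toBilin' (G.map (Int.cast : ℤ → ℚ))).Nondegenerate := by
  refine LinearMap.BilinForm.nondegenerate_toBilin'_of_det_ne_zero' _ ?_
  have h : (G.map (Int.cast : ℤ → ℚ)).det = ((G.det : ℤ) : ℚ) := (Int.cast_det G).symm
  rw [h]
  rcases Int.isUnit_iff.1 hG with h1 | h1 <;> simp [h1]

/-- **A `ℂ`-linear endomorphism of `ℂ^ι` mapping `ℤ^ι` into `ℚ^ι` is the complexification of a
`ℚ`-linear endomorphism `τ` of `ℚ^ι`** (`σ ∘ ι = ι ∘ τ`; the generic form of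
`exists_ratEnd_of_forall_intCast`). [folklore] -/
theorem exists_ratEnd_of_forall_intCast' (σ : Module.End ℂ (ι → ℂ))
    (hrat : ∀ v : ι → ℤ, ∃ w : ι → ℚ, σ (fun i => (v i : ℂ)) = fun i => (w i : ℂ)) :
    ∃ τ : Module.End ℚ (ι → ℚ),
      ∀ u : ι → ℚ, σ (fun i => (u i : ℂ)) = fun i => (τ u i : ℂ) := by
  classical
  choose w hw using hrat
  refine ⟨Matrix.toLin' (Matrix.of fun i j => w (Pi.single j 1) i), fun u => ?_⟩
  have hu : (fun i => (u i : ℂ)) = ∑ j, (u j : ℂ) • fun i => ((Pi.single j (1 : ℤ) : ι → ℤ) i : ℂ) := by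
    funext i
    simp only [Finset.sum_apply, Pi.smul_apply, smul_eq_mul, Pi.single_apply, Int.cast_ite,
      Int.cast_one, Int.cast_zero, mul_ite, mul_one, mul_zero]
    rw [Finset.sum_ite_eq, if_pos (Finset.mem_univ i)]
  rw [hu, map_sum]
  funext i
  simp only [map_smul, hw, Finset.sum_apply, Pi.smul_apply, smul_eq_mul, Matrix.toLin'_apply,
    Matrix.mulVec, dotProduct, Matrix.of_apply, Rat.cast_sum, Rat.cast_mul]
  refine Finset.sum_congr rfl fun j _ => ?_
  ring

/-- **A similitude of the rational form complexifies to a similitude of the complex form**: if a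
`ℂ`-linear `Ξ` restricts on `ℚ^ι` to a `ℚ`-linear `ξ` multiplying the rational form `xᵀ G y` by
`r`, then `Ξ` multiplies the complex form by `r` (both sides are `ℂ`-bilinear and agree on the
rational standard basis). [folklore] -/
theorem toBilin'_of_ratRestriction (G : Matrix ι ι ℤ) (Ξ : Module.End ℂ (ι → ℂ))
    (ξ : Module.End ℚ (ι → ℚ))
    (hΞ : ∀ u : ι → ℚ, Ξ (fun i => (u i : ℂ)) = fun i => (ξ u i : ℂ)) (r : ℚ)
    (hξ : ∀ u v, Matrix.toBilin' (G.map (Int.cast : ℤ → ℚ)) (ξ u) (ξ v) =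
      r * Matrix.toBilin' (G.map (Int.cast : ℤ → ℚ)) u v) (a b : ι → ℂ) :
    Matrix.toBilin' (G.map (Int.cast : ℤ → ℂ)) (Ξ a) (Ξ b) =
      (r : ℂ) * Matrix.toBilin' (G.map (Int.cast : ℤ → ℂ)) a b := by
  set B := Matrix.toBilin' (G.map (Int.cast : ℤ → ℂ)) with hB
  have h : B.compl₁₂ Ξ Ξ = (r : ℂ) • B := by
    refine LinearMap.ext_basis (Pi.basisFun ℂ ι) (Pi.basisFun ℂ ι) fun i j => ?_
    rw [basisFun_eq_ratCastVec, basisFun_eq_ratCastVec, LinearMap.compl₁₂_apply, LinearMap.smul_apply,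
      LinearMap.smul_apply, hΞ, hΞ, hB, toBilin'_map_ratCast, toBilin'_map_ratCast, hξ, Rat.cast_mul,
      smul_eq_mul]
  have h' := LinearMap.congr_fun₂ h a b
  rw [LinearMap.compl₁₂_apply, LinearMap.smul_apply, LinearMap.smul_apply, smul_eq_mul] at h'
  exact h'

end Form

/-! ### Bookkeeping in an integral marking of `H²(S(ℂ); ℂ)` -/

section Marking

variable {S : SchemeOver ℂ} {ι : Type} [Fintype ι] [DecidableEq ι]

omit [DecidableEq ι] in
/-- **Under an integral marking, the rational classes are exactly `η⁻¹(ℚ^ι)`.** If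
`η : H²(S(ℂ); ℂ) ≅ ℂ^ι` identifies the integral classes with `ℤ^ι` (`S` smooth projective of
dimension `2`), it identifies the rational classes with `ℚ^ι`: rational classes have integral
multiples (`IsRationalClass.exists_nsmul_isIntegralClass`), and rational vectors have integral
multiples (clearing denominators). The generic form of `isRationalClass_iff_of_marking`.
[cite: VoisinHodgeI2002, §7.1.1] -/
theorem isRationalClass_iff_of_integralMarking (hS : IsSmoothProjective 2 S)
    (η : complexBetti S (2 * 1) ≃ₗ[ℂ] (ι → ℂ))
    (hη : ∀ c : complexBetti S (2 * 1), IsIntegralClass c ↔ ∃ v : ι → ℤ, η c = fun i => (v i : ℂ))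
    (c : complexBetti S (2 * 1)) :
    IsRationalClass c ↔ ∃ w : ι → ℚ, η c = fun i => (w i : ℂ) := by
  constructor
  · intro hc
    obtain ⟨N, hN, hNc⟩ := hc.exists_nsmul_isIntegralClass hS
    obtain ⟨v, hv⟩ := (hη _).1 hNc
    refine ⟨fun i => (v i : ℚ) / N, ?_⟩
    have hN' : (N : ℂ) ≠ 0 := Nat.cast_ne_zero.2 hN.ne'
    rw [map_smul] at hv
    funext i
    have hi : (N : ℂ) * η c i = (v i : ℂ) := by
      have := congrFun hv i
      simpa only [Pi.smul_apply, smul_eq_mul] using this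
    rw [Rat.cast_div, Rat.cast_intCast, Rat.cast_natCast, ← hi]
    field_simp
  · rintro ⟨w, hw⟩
    obtain ⟨⟨D, hD⟩, hDw⟩ := IsLocalization.exist_integer_multiples_of_finite (nonZeroDivisors ℤ) w
    choose m hm using hDw
    have hD0 : (D : ℤ) ≠ 0 := nonZeroDivisors.ne_zero hD
    have hDC : (D : ℂ) ≠ 0 := Int.cast_ne_zero.2 hD0
    -- `D • c` has the integral coordinates `m`
    have hm' : ∀ i, (m i : ℂ) = (D : ℂ) * (w i : ℂ) := fun i => by
      have h1 : ((algebraMap ℤ ℚ) (m i) : ℂ) = (((D : ℤ) • w i : ℚ) : ℂ) := by rw [hm i]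
      rw [zsmul_eq_mul, Rat.cast_mul, Rat.cast_intCast, eq_intCast, Rat.cast_intCast] at h1
      exact h1
    have hint : IsIntegralClass ((D : ℂ) • c) := by
      refine (hη _).2 ⟨m, ?_⟩
      rw [map_smul, hw]
      funext i
      rw [Pi.smul_apply, smul_eq_mul, hm' i]
    have hc : c = (((D : ℚ)⁻¹ : ℚ) : ℂ) • ((D : ℂ) • c) := by
      rw [smul_smul, Rat.cast_inv, Rat.cast_intCast, inv_mul_cancel₀ hDC, one_smul]
    rw [hc]
    exact hint.isRationalClass.smul _

/-- **An endomorphism preserving rational classes, read in an integral marking, is defined over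
`ℚ`**: for `η` as in `isRationalClass_iff_of_integralMarking` and a `ℂ`-linear `φ` mapping
rational classes to rational classes, `η ∘ φ ∘ η⁻¹` maps `ℤ^ι` into `ℚ^ι`, hence is the
complexification of a `ℚ`-linear endomorphism of `ℚ^ι`. [cite: Buskin2019, §6.2 (markings and rational maps)] -/
theorem exists_ratEnd_of_integralMarking (hS : IsSmoothProjective 2 S)
    (η : complexBetti S (2 * 1) ≃ₗ[ℂ] (ι → ℂ))
    (hη : ∀ c : complexBetti S (2 * 1), IsIntegralClass c ↔ ∃ v : ι → ℤ, η c = fun i => (v i : ℂ))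
    (φ : complexBetti S (2 * 1) →ₗ[ℂ] complexBetti S (2 * 1))
    (hφ : ∀ x, IsRationalClass x → IsRationalClass (φ x)) :
    ∃ τ : Module.End ℚ (ι → ℚ),
      ∀ u : ι → ℚ, η (φ (η.symm fun i => (u i : ℂ))) = fun i => (τ u i : ℂ) := by
  have hrat : ∀ v : ι → ℤ, ∃ w : ι → ℚ,
      (η.toLinearMap ∘ₗ φ ∘ₗ η.symm.toLinearMap) (fun i => (v i : ℂ)) = fun i => (w i : ℂ) := by
    intro v
    have hint : IsIntegralClass (η.symm fun i => (v i : ℂ)) := (hη _).2 ⟨v, η.apply_symm_apply _⟩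
    obtain ⟨w, hw⟩ := (isRationalClass_iff_of_integralMarking hS η hη _).1 (hφ _ hint.isRationalClass)
    exact ⟨w, by simpa only [LinearMap.coe_comp, LinearEquiv.coe_coe, Function.comp_apply] using hw⟩
  obtain ⟨τ, hτ⟩ := exists_ratEnd_of_forall_intCast' _ hrat
  exact ⟨τ, fun u => by
    simpa only [LinearMap.coe_comp, LinearEquiv.coe_coe, Function.comp_apply] using hτ u⟩

/-- **Integral markings are real**: under a marking `η : H²(S(ℂ); ℂ) ≅ ℂ^ι` identifying the
integral classes with `ℤ^ι`, complex conjugation of classes is complex conjugation of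
coordinates, `conj (η⁻¹ z) = η⁻¹ z̄` (the basis `η⁻¹ eⱼ` consists of integral, hence real, classes;
the generic form of `conjClass_marking_symm`). [cite: VoisinHodgeI2002, Cor. 6.12] -/
theorem conjClass_integralMarking_symm
    (η : complexBetti S (2 * 1) ≃ₗ[ℂ] (ι → ℂ))
    (hη : ∀ c : complexBetti S (2 * 1), IsIntegralClass c ↔ ∃ v : ι → ℤ, η c = fun i => (v i : ℂ))
    (z : ι → ℂ) :
    conjClass (ComplexPoints S) (2 * 1) (η.symm z) = η.symm (star z) := by
  classical
  have hint : ∀ j : ι,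
      IsIntegralClass (η.symm fun i => ((Pi.single j (1 : ℤ) : ι → ℤ) i : ℂ)) := fun j =>
    (hη _).2 ⟨Pi.single j 1, η.apply_symm_apply _⟩
  have hstar : ∀ j : ι, star (fun i => ((Pi.single j (1 : ℤ) : ι → ℤ) i : ℂ)) =
      fun i => ((Pi.single j (1 : ℤ) : ι → ℤ) i : ℂ) := fun j => by
    funext i
    rw [Pi.star_apply, Complex.star_def]
    exact map_intCast _ _
  have hsz : star z = ∑ j, star (z j) • fun i => ((Pi.single j (1 : ℤ) : ι → ℤ) i : ℂ) := by
    conv_lhs => rw [eq_sum_smul_intCastVec_single z]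
    rw [star_sum]
    refine Finset.sum_congr rfl fun j _ => ?_
    rw [star_smul, hstar]
  conv_lhs => rw [eq_sum_smul_intCastVec_single z]
  rw [hsz, map_sum, map_sum, ← conjClassEquiv_apply, map_sum]
  refine Finset.sum_congr rfl fun j _ => ?_
  rw [conjClassEquiv_apply, map_smul, map_smul, conjClass_smul,
    (hint j).isRationalClass.conjClass_eq, starRingEnd_apply]

/-- **An endomorphism preserving rational classes commutes with complex conjugation**
(`conj (φ x) = φ (conj x)`): both sides are conjugate-linear in `x` and agree on the integral
basis `η⁻¹ eⱼ` of a marking, whose images under `φ` are rational, hence real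
(`IsRationalClass.conjClass_eq`). [cite: VoisinHodgeI2002, Cor. 6.12] -/
theorem conjClass_apply_of_isRationalClass
    (η : complexBetti S (2 * 1) ≃ₗ[ℂ] (ι → ℂ))
    (hη : ∀ c : complexBetti S (2 * 1), IsIntegralClass c ↔ ∃ v : ι → ℤ, η c = fun i => (v i : ℂ))
    (φ : complexBetti S (2 * 1) →ₗ[ℂ] complexBetti S (2 * 1))
    (hφ : ∀ x, IsRationalClass x → IsRationalClass (φ x)) (x : complexBetti S (2 * 1)) :
    conjClass (ComplexPoints S) (2 * 1) (φ x) = φ (conjClass (ComplexPoints S) (2 * 1) x) := by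
  classical
  have hint : ∀ j : ι,
      IsIntegralClass (η.symm fun i => ((Pi.single j (1 : ℤ) : ι → ℤ) i : ℂ)) := fun j =>
    (hη _).2 ⟨Pi.single j 1, η.apply_symm_apply _⟩
  have hx : x = ∑ j, (η x) j • η.symm (fun i => ((Pi.single j (1 : ℤ) : ι → ℤ) i : ℂ)) := by
    apply η.injective
    rw [map_sum]
    simp_rw [map_smul, LinearEquiv.apply_symm_apply]
    exact eq_sum_smul_intCastVec_single (η x)
  have key : ∀ j, conjClassEquiv (ComplexPoints S) (2 * 1)
      (φ ((η x) j • η.symm (fun i => ((Pi.single j (1 : ℤ) : ι → ℤ) i : ℂ)))) =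
      φ (conjClassEquiv (ComplexPoints S) (2 * 1)
        ((η x) j • η.symm (fun i => ((Pi.single j (1 : ℤ) : ι → ℤ) i : ℂ)))) := fun j => by
    rw [conjClassEquiv_apply, conjClassEquiv_apply, map_smul, conjClass_smul, conjClass_smul,
      map_smul, (hint j).isRationalClass.conjClass_eq,
      (hφ _ (hint j).isRationalClass).conjClass_eq]
  calc conjClass (ComplexPoints S) (2 * 1) (φ x)
      = conjClassEquiv (ComplexPoints S) (2 * 1) (φ x) := rfl
    _ = ∑ j, conjClassEquiv (ComplexPoints S) (2 * 1)
          (φ ((η x) j • η.symm (fun i => ((Pi.single j (1 : ℤ) : ι → ℤ) i : ℂ)))) := by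
        conv_lhs => rw [hx]
        rw [map_sum, map_sum]
    _ = ∑ j, φ (conjClassEquiv (ComplexPoints S) (2 * 1)
          ((η x) j • η.symm (fun i => ((Pi.single j (1 : ℤ) : ι → ℤ) i : ℂ)))) :=
        Finset.sum_congr rfl fun j _ => key j
    _ = φ (conjClassEquiv (ComplexPoints S) (2 * 1) x) := by
        conv_rhs => rw [hx]
        rw [map_sum, map_sum]
    _ = φ (conjClass (ComplexPoints S) (2 * 1) x) := rfl

/-- **Rational classes span `H²(S(ℂ); ℂ)`, marking form**: every class is a complex combination
of the integral basis classes `η⁻¹ eⱼ`. [cite: VoisinHodgeI2002, §7.1.1] -/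
theorem eq_sum_smul_integralMarking_single (η : complexBetti S (2 * 1) ≃ₗ[ℂ] (ι → ℂ))
    (x : complexBetti S (2 * 1)) :
    x = ∑ j, (η x) j • η.symm (fun i => ((Pi.single j (1 : ℤ) : ι → ℤ) i : ℂ)) := by
  apply η.injective
  rw [map_sum]
  simp_rw [map_smul, LinearEquiv.apply_symm_apply]
  exact eq_sum_smul_intCastVec_single (η x)

end Marking

end Summit.HodgeConjecture.HodgeConjecture.Theorems.NikulinTwinTransport

end
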